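import Summits.CriticalPhenomena.PercolationContinuityZ3.Theorems.PercNearOneGluingNoHeavyPcintBSMRTail
import HarnessLib

/-!
# PCINT lane, PHASE 9 (block renewal with reach-`m` pieces): the Laplace bound with a harmonic cut-off

Cell `prim-pcint`, seat `prim-pcint-1` (gen 17); memo `run/shared/lean/prim/pcint/T-FIBRE-ROUTE.md` §PHASE 9.

`BSMR.H_le_fourier` (…PcintBSMRFourier) bounds `1 - φ(θ) ≥ c θ²` on `|θ| ≤ θ₀` using `1 - cos x ≥ x²/2 - (5/96)x⁴`
(`|x| ≤ 1`) for EVERY harmonic, which forces `m θ₀ ≤ 1`; for `k ≥ 3` time axes (short horizons `N`) the resulting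
small gap `m₀ ≤ (g(-1)+g(1)) L(θ₀)` makes the geometric part of the tail dominant.  Here the quartic bound is applied
only to the harmonics `v` with `|v| θ₀ ≤ 1` and the others are dropped (`1 - cos ≥ 0`): **`BSMR.H_le_fourierB`** with
`c ≤ Σ_c g c · LA(val c, θ₀)`, `LA(v, θ₀) = 𝟙[|v| θ₀ ≤ 1] (v²/2 - (5/96) v⁴ θ₀²)` (`BSMR.LA`), any `0 < θ₀ ≤ 1`.
The tail package is repeated for these data (`BSMR.FDataB`, **`BSMR.tailBoundH_of_twoFourierQB`**,
**`BSMR.tailBoundH_of_threeFourierQB`**, decidable side conditions `BSMR.FourierCheckQB`).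
-/

noncomputable section

namespace Summit.CriticalPhenomena.PercolationContinuityZ3.Theorems.Pcint.BSMR

open Finset OSM BSM Real

variable {m t k : ℕ}

/-! ### Region A with a harmonic cut-off -/

/-- The region-A coefficient of a harmonic `v`: `𝟙[|v| θ₀ ≤ 1] (v²/2 - (5/96) v⁴ θ₀²)`. -/
def LA (v : ℤ) (θ₀ : ℝ) : ℝ := if |(v : ℝ)| * θ₀ ≤ 1 then (v : ℝ) ^ 2 / 2 - 5 / 96 * (v : ℝ) ^ 4 * θ₀ ^ 2 else 0

/-- The region-A constant bound: `cA = Σ_c g c · LA (val c) θ₀`. -/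
def cA (m : ℕ) (g : Fin (2 * m + 1) → ℝ) (θ₀ : ℝ) : ℝ := ∑ c : Fin (2 * m + 1), g c * LA (val m c) θ₀

/-- **Region A** (`|θ| ≤ θ₀`): `1 - φ(θ) ≥ c θ²` whenever `c ≤ cA`. -/
theorem sq_mul_le_one_sub_symB {g : Fin (2 * m + 1) → ℝ} (hg : LawOK m g) {θ₀ c θ : ℝ}
    (hc : c ≤ cA m g θ₀) (hθ : |θ| ≤ θ₀) : c * θ ^ 2 ≤ 1 - sym m g θ := by
  rw [one_sub_sym hg]
  have hθ₀0 : 0 ≤ θ₀ := (abs_nonneg θ).trans hθ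
  have hsq : θ ^ 2 ≤ θ₀ ^ 2 := by
    have := sq_abs θ; rw [← this]; exact pow_le_pow_left₀ (abs_nonneg θ) hθ 2
  have ht2 : 0 ≤ θ ^ 2 := sq_nonneg θ
  have hterm : ∀ c : Fin (2 * m + 1), g c * (LA (val m c) θ₀ * θ ^ 2) ≤ g c * (1 - Real.cos (val m c * θ)) := by
    intro c
    refine mul_le_mul_of_nonneg_left ?_ (hg.nonneg c)
    unfold LA
    split_ifs with hv
    · have hvθ : |(val m c : ℝ) * θ| ≤ 1 := by
        rw [abs_mul]
        calc |(val m c : ℝ)| * |θ| ≤ |(val m c : ℝ)| * θ₀ := mul_le_mul_of_nonneg_left hθ (abs_nonneg _)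
          _ ≤ 1 := hv
      have := BSMX.Lcos_le hvθ
      unfold BSMX.Lcos at this
      have h4 : (val m c : ℝ) ^ 4 * θ ^ 4 ≤ (val m c : ℝ) ^ 4 * (θ₀ ^ 2 * θ ^ 2) := by
        rw [show θ ^ 4 = θ ^ 2 * θ ^ 2 by ring]
        exact mul_le_mul_of_nonneg_left (mul_le_mul_of_nonneg_right hsq ht2) (by positivity)
      calc ((val m c : ℝ) ^ 2 / 2 - 5 / 96 * (val m c : ℝ) ^ 4 * θ₀ ^ 2) * θ ^ 2
          ≤ ((val m c : ℝ) * θ) ^ 2 / 2 - 5 / 96 * ((val m c : ℝ) * θ) ^ 4 := by nlinarith [h4]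
        _ ≤ _ := this
    · rw [zero_mul]; exact sub_nonneg.2 (Real.cos_le_one _)
  have hsum := sum_le_sum fun c (_ : c ∈ (univ : Finset (Fin (2 * m + 1)))) => hterm c
  have hL : ∑ c : Fin (2 * m + 1), g c * (LA (val m c) θ₀ * θ ^ 2) = cA m g θ₀ * θ ^ 2 := by
    unfold cA; rw [Finset.sum_mul]; exact sum_congr rfl fun c _ => by ring
  rw [hL] at hsum
  exact (mul_le_mul_of_nonneg_right hc ht2).trans hsum

/-- **The pointwise bound on `[-π, π]`** with the cut-off constant. -/
theorem sym_pow_leB {g : Fin (2 * m + 1) → ℝ} (hg : LawOK m g) (hm : 1 ≤ m) (hctr : 1 ≤ 2 * g (ctr m))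
    {θ₀ c m₀ : ℝ} (hθ₀0 : 0 ≤ θ₀) (hθ₀1 : θ₀ ≤ 1) (hc : c ≤ cA m g θ₀)
    (hmB : m₀ ≤ (g (oneN m) + g (oneP m)) * BSMX.Lcos θ₀) (n : ℕ) {θ : ℝ} (hθ : |θ| ≤ π) :
    sym m g θ ^ n ≤ Real.exp (-((n : ℝ) * c) * θ ^ 2) + Real.exp (-((n : ℝ) * m₀)) := by
  have hs := sym_nonneg hg hctr θ
  have h0 := BSMX.pow_le_exp_neg hs n
  have eA := Real.exp_pos (-((n : ℝ) * c) * θ ^ 2)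
  have eB := Real.exp_pos (-((n : ℝ) * m₀))
  rcases le_or_gt |θ| θ₀ with hA | hBC
  · have hq := sq_mul_le_one_sub_symB hg hc hA
    have : Real.exp (-((n : ℝ) * (1 - sym m g θ))) ≤ Real.exp (-((n : ℝ) * c) * θ ^ 2) := by
      rw [Real.exp_le_exp]
      have := mul_le_mul_of_nonneg_left hq (Nat.cast_nonneg n)
      linarith
    linarith
  · have hq := le_one_sub_sym hg hm hθ₀0 hθ₀1 hmB hBC.le hθ
    have : Real.exp (-((n : ℝ) * (1 - sym m g θ))) ≤ Real.exp (-((n : ℝ) * m₀)) := by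
      rw [Real.exp_le_exp]
      have := mul_le_mul_of_nonneg_left hq (Nat.cast_nonneg n)
      linarith
    linarith

/-- **The Laplace bound with the harmonic cut-off**: `H m g n δ ≤ 1/(2√(π c n)) + exp(-m₀ n)` for `n ≥ 1`. -/
theorem H_le_fourierB {g : Fin (2 * m + 1) → ℝ} (hg : LawOK m g) (hm : 1 ≤ m) (hctr : 1 ≤ 2 * g (ctr m))
    {θ₀ c m₀ : ℝ} (hθ₀0 : 0 < θ₀) (hθ₀1 : θ₀ ≤ 1) (hc0 : 0 < c) (hc : c ≤ cA m g θ₀)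
    (hmB : m₀ ≤ (g (oneN m) + g (oneP m)) * BSMX.Lcos θ₀) {n : ℕ} (hn : 1 ≤ n) (δ : ℤ) :
    H m g n δ ≤ 1 / (2 * Real.sqrt (π * c * n)) + Real.exp (-(m₀ * n)) := by
  have hπ := Real.pi_pos
  have hnR : (0 : ℝ) < n := by exact_mod_cast hn
  have hb : 0 < (n : ℝ) * c := by positivity
  have hcs := continuous_sym (m := m) g
  have hpt : ∀ θ ∈ Set.Icc (-π) π, sym m g θ ^ n * Real.cos (δ * θ) ≤
      Real.exp (-((n : ℝ) * c) * θ ^ 2) + Real.exp (-((n : ℝ) * m₀)) := by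
    intro θ hθ
    have habs : |θ| ≤ π := abs_le.2 ⟨hθ.1, hθ.2⟩
    have hsn : 0 ≤ sym m g θ ^ n := pow_nonneg (sym_nonneg hg hctr θ) n
    calc sym m g θ ^ n * Real.cos (δ * θ) ≤ sym m g θ ^ n * 1 :=
          mul_le_mul_of_nonneg_left (Real.cos_le_one _) hsn
      _ ≤ _ := by rw [mul_one]; exact sym_pow_leB hg hm hctr hθ₀0.le hθ₀1 hc hmB n habs
  have hmono : ∫ θ in (-π)..π, sym m g θ ^ n * Real.cos (δ * θ) ≤
      ∫ θ in (-π)..π, (Real.exp (-((n : ℝ) * c) * θ ^ 2) + Real.exp (-((n : ℝ) * m₀))) :=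
    intervalIntegral.integral_mono_on (by linarith) ((by fun_prop : Continuous fun θ =>
      sym m g θ ^ n * Real.cos (δ * θ)).intervalIntegrable _ _)
      ((by fun_prop : Continuous fun θ : ℝ =>
        Real.exp (-((n : ℝ) * c) * θ ^ 2) + Real.exp (-((n : ℝ) * m₀))).intervalIntegrable _ _) hpt
  have hsplit : ∫ θ in (-π)..π, (Real.exp (-((n : ℝ) * c) * θ ^ 2) + Real.exp (-((n : ℝ) * m₀))) =
      (∫ θ in (-π)..π, Real.exp (-((n : ℝ) * c) * θ ^ 2)) + 2 * π * Real.exp (-((n : ℝ) * m₀)) := by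
    rw [intervalIntegral.integral_add ((by fun_prop : Continuous fun θ : ℝ =>
        Real.exp (-((n : ℝ) * c) * θ ^ 2)).intervalIntegrable _ _) (intervalIntegrable_const),
      intervalIntegral.integral_const, smul_eq_mul]
    ring
  have hgi := BSMX.integral_exp_neg_mul_sq_le hb
  rw [H_eq_integral hg, div_le_iff₀ (by positivity : (0 : ℝ) < 2 * π)]
  calc ∫ θ in (-π)..π, sym m g θ ^ n * Real.cos (δ * θ)
      ≤ Real.sqrt (π / ((n : ℝ) * c)) + 2 * π * Real.exp (-((n : ℝ) * m₀)) := by rw [hsplit] at hmono; linarith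
    _ = (1 / (2 * Real.sqrt (π * c * n)) + Real.exp (-(m₀ * n))) * (2 * π) := by
        rw [← BSMX.sqrt_div_two_pi hc0 hnR, show -(m₀ * (n : ℝ)) = -((n : ℝ) * m₀) by ring]
        field_simp

/-! ### The tail package for the cut-off data -/

/-- **Fourier data with cut-off**: admissible concentrated law, `m ≥ 1`, `0 < θ₀ ≤ 1`, `0 < c ≤ cA`,
`0 < m₀ ≤ (g(-1)+g(1)) L(θ₀)`. -/
def FDataB (m : ℕ) (g : Fin (2 * m + 1) → ℝ) (θ₀ c m₀ : ℝ) : Prop :=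
  LawOK m g ∧ 1 ≤ m ∧ 1 ≤ 2 * g (ctr m) ∧ 0 < θ₀ ∧ θ₀ ≤ 1 ∧ 0 < c ∧ c ≤ cA m g θ₀ ∧ 0 < m₀ ∧
    m₀ ≤ (g (oneN m) + g (oneP m)) * BSMX.Lcos θ₀

/-- `H (2i) δ ≤ HB i` for `i ≥ 1` (cut-off data). -/
theorem H_two_mul_le_HB_B {g : Fin (2 * m + 1) → ℝ} {θ₀ c m₀ : ℝ} (h : FDataB m g θ₀ c m₀) {i : ℕ} (hi : 1 ≤ i)
    (δ : ℤ) : H m g (2 * i) δ ≤ BSMX.HB c m₀ i := by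
  obtain ⟨hg, hm, hctr, hθ0, hθ1, hc0, hc, _, hm₀⟩ := h
  have := H_le_fourierB hg hm hctr hθ0 hθ1 hc0 hc hm₀ (n := 2 * i) (by omega) δ
  unfold BSMX.HB
  push_cast at this
  exact this

/-- **The transverse factor bound**: `Π_l H (2i) (δ l) ≤ bF i` (`t ≥ 2`, cut-off data). -/
theorem prod_H_le_bF_B {g : Fin (2 * m + 1) → ℝ} {θ₀ c m₀ κ : ℝ} (h : FDataB m g θ₀ c m₀) (hκ : 0 ≤ κ)
    (hκ2 : 1 ≤ κ ^ 2 * (2 * π * c)) (ht : 2 ≤ t) (i : ℕ) (δ : Fin t → ℤ) :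
    ∏ l, H m g (2 * i) (δ l) ≤ BSMX.bF c m₀ κ i := by
  have hg := h.1
  unfold BSMX.bF
  split_ifs with hi
  · exact prod_H_le_one hg _ δ
  · have hi1 : 1 ≤ i := Nat.one_le_iff_ne_zero.2 hi
    refine (prod_H_le_two hg ht (2 * i) δ).trans ?_
    have h0 := fun l => H_nonneg hg (2 * i) (δ l)
    have e0 := H_two_mul_le_HB_B h hi1 (δ ⟨0, by omega⟩)
    have e1 := H_two_mul_le_HB_B h hi1 (δ ⟨1, by omega⟩)
    calc H m g (2 * i) (δ ⟨0, by omega⟩) * H m g (2 * i) (δ ⟨1, by omega⟩) ≤ BSMX.HB c m₀ i * BSMX.HB c m₀ i :=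
          mul_le_mul e0 e1 (h0 _) (BSMX.HB_nonneg c m₀ i)
      _ = BSMX.HB c m₀ i ^ 2 := (sq _).symm
      _ ≤ _ := BSMX.HB_sq_le h.2.2.2.2.2.1 h.2.2.2.2.2.2.2.1.le hκ hκ2 hi1

/-- **The Fourier tail for two time axes** (cut-off data). -/
theorem tailBound_two_fourierB {g : Fin (2 * m + 1) → ℝ} {θ₀ c m₀ κ : ℝ} (h : FDataB m g θ₀ c m₀) (hκ : 0 ≤ κ)
    (hκ2 : 1 ≤ κ ^ 2 * (2 * π * c)) (ht : 2 ≤ t) {N : ℕ} (hN : 1 ≤ N) {T : ℝ}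
    (hT : u 2 N * ((2 * (N : ℝ) + 2) / (8 * π * c * N) +
      (κ + 1) * Real.exp (-m₀) ^ (2 * N) / (1 - Real.exp (-m₀) ^ 2)) ≤ T) :
    TailBoundH t 2 m g N T := by
  have hπ := Real.pi_pos; have hc := h.2.2.2.2.2.1; have hm₀ := h.2.2.2.2.2.2.2.1
  set r := Real.exp (-m₀) with hr
  have hr0 : 0 ≤ r := (Real.exp_pos _).le
  have hr1 : r < 1 := Real.exp_lt_one_iff.2 (by linarith)
  have hr2 : 0 < 1 - r ^ 2 := by nlinarith
  have huN := u_nonneg (d := 2) N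
  have hT0 : 0 ≤ u 2 N * ((2 * (N : ℝ) + 2) / (8 * π * c * N) + (κ + 1) * r ^ (2 * N) / (1 - r ^ 2)) := by positivity
  refine tailBoundH_of_window' h.1 le_rfl (fun i δ => prod_H_le_bF_B h hκ hκ2 ht i δ) (hT0.trans hT)
    fun M => le_trans ?_ hT
  have hsplit : ∑ i ∈ Ico N M, u 2 i * BSMX.bF c m₀ κ i =
      (1 / (8 * π * c)) * ∑ i ∈ Ico N M, u 2 i / (i : ℝ) + (κ + 1) * ∑ i ∈ Ico N M, u 2 i * r ^ (2 * i) := by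
    rw [mul_sum, mul_sum, ← sum_add_distrib]
    refine sum_congr rfl fun i hi => ?_
    have hi1 : i ≠ 0 := by have := (mem_Ico.1 hi).1; omega
    have hi0 : (0 : ℝ) < i := by exact_mod_cast Nat.pos_of_ne_zero hi1
    rw [BSMX.bF, if_neg hi1, hr]
    field_simp
  rw [hsplit]
  have h1 := BSMX.window_two_inv hN M
  have h2 := BSMX.window_geo hr0 hr1 N M
  have hNR : (0 : ℝ) < N := by exact_mod_cast hN
  calc 1 / (8 * π * c) * ∑ i ∈ Ico N M, u 2 i / (i : ℝ) + (κ + 1) * ∑ i ∈ Ico N M, u 2 i * r ^ (2 * i)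
      ≤ 1 / (8 * π * c) * (u 2 N * (2 * (N : ℝ) + 2) / N) + (κ + 1) * (u 2 N * r ^ (2 * N) / (1 - r ^ 2)) :=
        add_le_add (mul_le_mul_of_nonneg_left h1 (by positivity)) (mul_le_mul_of_nonneg_left h2 (by positivity))
    _ = u 2 N * ((2 * (N : ℝ) + 2) / (8 * π * c * N) + (κ + 1) * r ^ (2 * N) / (1 - r ^ 2)) := by
        field_simp

/-- **The Fourier tail for `k ≥ 3` time axes** (cut-off data). -/
theorem tailBound_three_fourierB {g : Fin (2 * m + 1) → ℝ} {θ₀ c m₀ κ : ℝ} (h : FDataB m g θ₀ c m₀) (hκ : 0 ≤ κ)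
    (hκ2 : 1 ≤ κ ^ 2 * (2 * π * c)) (hk : 3 ≤ k) (ht : 2 ≤ t) {q₀ N : ℕ} (hN : q₀ * k ≤ N) (hN1 : 1 ≤ N) {T : ℝ}
    (hT : BSMX.Cu k q₀ * (1 / (8 * π * c * N) +
      (κ + 1) * Real.exp (-m₀) ^ (2 * N) / (((N : ℝ) + 1) * (1 - Real.exp (-m₀) ^ 2))) ≤ T) :
    TailBoundH t k m g N T := by
  have hπ := Real.pi_pos; have hc := h.2.2.2.2.2.1; have hm₀ := h.2.2.2.2.2.2.2.1
  have hk0 : 0 < k := by omega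
  set r := Real.exp (-m₀) with hr
  have hr0 : 0 ≤ r := (Real.exp_pos _).le
  have hr1 : r < 1 := Real.exp_lt_one_iff.2 (by linarith)
  have hr2 : 0 < 1 - r ^ 2 := by nlinarith
  have hC := BSMX.Cu_nonneg hk0 q₀
  have hT0 : 0 ≤ BSMX.Cu k q₀ * (1 / (8 * π * c * N) + (κ + 1) * r ^ (2 * N) / (((N : ℝ) + 1) * (1 - r ^ 2))) := by
    positivity
  refine tailBoundH_of_window' h.1 (by omega) (fun i δ => prod_H_le_bF_B h hκ hκ2 ht i δ) (hT0.trans hT)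
    fun M => le_trans ?_ hT
  have hterm : ∀ i ∈ Ico N M, u k i * BSMX.bF c m₀ κ i ≤
      BSMX.Cu k q₀ / (8 * π * c) * (1 / (i : ℝ) - 1 / ((i : ℝ) + 1)) +
        (κ + 1) * BSMX.Cu k q₀ * (r ^ (2 * i) / ((i : ℝ) + 1)) := by
    intro i hi
    have hNi := (mem_Ico.1 hi).1
    have hi1 : i ≠ 0 := by omega
    have hi0 : (0 : ℝ) < i := by exact_mod_cast Nat.pos_of_ne_zero hi1
    have hu := BSMX.u_mul_le hk (hN.trans hNi)
    have hu' : u k i ≤ BSMX.Cu k q₀ / ((i : ℝ) + 1) := by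
      rw [le_div_iff₀ (by positivity)]; unfold BSMX.Cu; linarith
    have hii : 1 / (i : ℝ) - 1 / ((i : ℝ) + 1) = 1 / ((i : ℝ) * ((i : ℝ) + 1)) := by field_simp; ring
    rw [BSMX.bF, if_neg hi1, ← hr, hii]
    have hb0 : 0 ≤ 1 / (8 * π * c * (i : ℝ)) + (κ + 1) * r ^ (2 * i) := by positivity
    calc u k i * (1 / (8 * π * c * (i : ℝ)) + (κ + 1) * r ^ (2 * i))
        ≤ BSMX.Cu k q₀ / ((i : ℝ) + 1) * (1 / (8 * π * c * (i : ℝ)) + (κ + 1) * r ^ (2 * i)) :=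
          mul_le_mul_of_nonneg_right hu' hb0
      _ = BSMX.Cu k q₀ / (8 * π * c) * (1 / ((i : ℝ) * ((i : ℝ) + 1))) +
          (κ + 1) * BSMX.Cu k q₀ * (r ^ (2 * i) / ((i : ℝ) + 1)) := by
          field_simp
  have h1 := sum_Ico_telescope_le N M
  have h2 := BSMX.window_geo_div hr0 hr1 N M
  have hNR : (0 : ℝ) < N := by exact_mod_cast hN1
  calc ∑ i ∈ Ico N M, u k i * BSMX.bF c m₀ κ i
      ≤ ∑ i ∈ Ico N M, (BSMX.Cu k q₀ / (8 * π * c) * (1 / (i : ℝ) - 1 / ((i : ℝ) + 1)) +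
          (κ + 1) * BSMX.Cu k q₀ * (r ^ (2 * i) / ((i : ℝ) + 1))) := sum_le_sum hterm
    _ = BSMX.Cu k q₀ / (8 * π * c) * ∑ i ∈ Ico N M, (1 / (i : ℝ) - 1 / ((i : ℝ) + 1)) +
          (κ + 1) * BSMX.Cu k q₀ * ∑ i ∈ Ico N M, r ^ (2 * i) / ((i : ℝ) + 1) := by
        rw [sum_add_distrib, mul_sum, mul_sum]
    _ ≤ BSMX.Cu k q₀ / (8 * π * c) * (1 / (N : ℝ)) +
          (κ + 1) * BSMX.Cu k q₀ * (r ^ (2 * N) / (((N : ℝ) + 1) * (1 - r ^ 2))) :=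
        add_le_add (mul_le_mul_of_nonneg_left h1 (by positivity)) (mul_le_mul_of_nonneg_left h2 (by positivity))
    _ = BSMX.Cu k q₀ * (1 / (8 * π * c * N) + (κ + 1) * r ^ (2 * N) / (((N : ℝ) + 1) * (1 - r ^ 2))) := by
        field_simp

/-! ### Kernel discharges from rational data -/

/-- The region-A coefficient over `ℚ`. -/
def LAQ (v : ℤ) (θ₀ : ℚ) : ℚ := if |(v : ℚ)| * θ₀ ≤ 1 then (v : ℚ) ^ 2 / 2 - 5 / 96 * (v : ℚ) ^ 4 * θ₀ ^ 2 else 0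

/-- `LAQ` casts to `LA`. -/
theorem LAQ_cast (v : ℤ) (θ₀ : ℚ) : ((LAQ v θ₀ : ℚ) : ℝ) = LA v (θ₀ : ℝ) := by
  unfold LAQ LA
  have : (|(v : ℚ)| * θ₀ ≤ 1) ↔ (|(v : ℝ)| * (θ₀ : ℝ) ≤ 1) := by
    rw [← Rat.cast_le (K := ℝ)]; push_cast; exact Iff.rfl
  by_cases h : |(v : ℚ)| * θ₀ ≤ 1
  · rw [if_pos h, if_pos (this.1 h)]; push_cast; ring
  · rw [if_neg h, if_neg (fun h' => h (this.2 h'))]; simp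

/-- The region-A constant over `ℚ` for the law `A/DA`. -/
def cAQ (m : ℕ) (A : List ℕ) (DA : ℕ) (θ₀ : ℚ) : ℚ :=
  ∑ c : Fin (2 * m + 1), ((A.getD c 0 : ℕ) : ℚ) / DA * LAQ ((c : ℤ) - m) θ₀

/-- `cAQ` casts to `cA`. -/
theorem cAQ_cast (A : List ℕ) (DA : ℕ) (θ₀ : ℚ) : ((cAQ m A DA θ₀ : ℚ) : ℝ) = cA m (lawN m A DA) θ₀ := by
  unfold cAQ cA lawN val; push_cast; simp_rw [LAQ_cast]

/-- **The decidable side conditions** (cut-off data) for the law `A/DA` with rational `θ₀, c, m₀, κ`. -/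
def FourierCheckQB (m : ℕ) (A : List ℕ) (DA : ℕ) (θ₀ c m₀ κ : ℚ) : Prop :=
  1 ≤ m ∧ DA ≤ 2 * A.getD m 0 ∧ 0 < θ₀ ∧ θ₀ ≤ 1 ∧ 0 < c ∧ c ≤ cAQ m A DA θ₀ ∧ 0 < m₀ ∧
    m₀ ≤ (((A.getD (m - 1) 0 : ℕ) : ℚ) / DA + ((A.getD (m + 1) 0 : ℕ) : ℚ) / DA) * BSMX.LcosQ θ₀ ∧
      0 ≤ κ ∧ 1 ≤ κ ^ 2 * (2 * BSMX.piLo * c)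

/-- **From the rational checks to the cut-off Fourier data** (and `κ² (2π c) ≥ 1`). -/
theorem fdataB_of_checkQ {A : List ℕ} {DA : ℕ} (hA : LawNatOK m A DA) {θ₀ c m₀ κ : ℚ}
    (hq : FourierCheckQB m A DA θ₀ c m₀ κ) :
    FDataB m (lawN m A DA) θ₀ c m₀ ∧ 0 ≤ (κ : ℝ) ∧ 1 ≤ (κ : ℝ) ^ 2 * (2 * π * c) := by
  obtain ⟨hm, hctr, hθ0, hθ1, hc0, hc1, hm0, hm1, hκ0, hκ1⟩ := hq
  have hlaw := lawOK_of_nat hA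
  have hDAR : (0 : ℝ) < DA := by exact_mod_cast hA.1
  have ectr : 1 ≤ 2 * lawN m A DA (ctr m) := by
    unfold lawN ctr
    have : (DA : ℝ) ≤ 2 * (A.getD m 0 : ℕ) := by exact_mod_cast hctr
    rw [show (2 : ℝ) * (((A.getD m 0 : ℕ) : ℝ) / DA) = (2 * (A.getD m 0 : ℕ)) / DA by ring, le_div_iff₀ hDAR]
    simpa using this
  have eθ0 : (0 : ℝ) < θ₀ := by exact_mod_cast hθ0
  have eθ1 : (θ₀ : ℝ) ≤ 1 := by have := (Rat.cast_le (K := ℝ)).2 hθ1; push_cast at this; exact this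
  have ec0 : (0 : ℝ) < c := by exact_mod_cast hc0
  have ec1 : (c : ℝ) ≤ cA m (lawN m A DA) θ₀ := by
    have := (Rat.cast_le (K := ℝ)).2 hc1; rw [cAQ_cast] at this; exact this
  have em0 : (0 : ℝ) < m₀ := by exact_mod_cast hm0
  have em1 : (m₀ : ℝ) ≤ (lawN m A DA (oneN m) + lawN m A DA (oneP m)) * BSMX.Lcos θ₀ := by
    have := (Rat.cast_le (K := ℝ)).2 hm1; push_cast at this; rw [BSMX.LcosQ_cast] at this
    have e1 : ((oneN m : Fin (2 * m + 1)) : ℕ) = m - 1 := rfl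
    have e2 : ((oneP m : Fin (2 * m + 1)) : ℕ) = m + 1 := by show min (m + 1) (2 * m) = m + 1; omega
    unfold lawN; rw [e1, e2]; exact this
  have eκ0 : (0 : ℝ) ≤ κ := by exact_mod_cast hκ0
  have eκ1 : (1 : ℝ) ≤ (κ : ℝ) ^ 2 * (2 * ((BSMX.piLo : ℚ) : ℝ) * c) := by
    have := (Rat.cast_le (K := ℝ)).2 hκ1; push_cast at this ⊢; exact this
  refine ⟨⟨hlaw, hm, ectr, eθ0, eθ1, ec0, ec1, em0, em1⟩, eκ0, eκ1.trans ?_⟩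
  have hp := BSMX.piLo_le_pi
  have : 0 ≤ (κ : ℝ) ^ 2 * (2 * c) := by positivity
  nlinarith [mul_le_mul_of_nonneg_left hp this]

/-- **The Fourier two-axes tail from a kernel check** (cut-off data, square form): with `ρ = 1/(1+m₀)`,
`X = (2N+2)/(8 piLo c N) + (κ+1) ρ^{2M}/(1-ρ²)` (`M ≤ N`), the check `X² ≤ (Tn/DG)² (3N+1)` gives the tail bound. -/
theorem tailBoundH_of_twoFourierQB (ht : 2 ≤ t) {A : List ℕ} {DA : ℕ} (hA : LawNatOK m A DA) {θ₀ c m₀ κ : ℚ}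
    (hq : FourierCheckQB m A DA θ₀ c m₀ κ) {M N : ℕ} (hMN : M ≤ N) (hN : 1 ≤ N) {Tn DG : ℕ}
    (h : ((2 * (N : ℚ) + 2) / (8 * BSMX.piLo * c * N) + (κ + 1) * (1 / (1 + m₀)) ^ (2 * M) / (1 - (1 / (1 + m₀)) ^ 2)) ^ 2 ≤
      ((Tn : ℚ) / DG) ^ 2 * (3 * (N : ℚ) + 1)) :
    TailBoundH t 2 m (lawN m A DA) N ((Tn : ℝ) / DG) := by
  obtain ⟨hF, hκ0, hκ1⟩ := fdataB_of_checkQ hA hq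
  set Xρ : ℝ := (2 * (N : ℝ) + 2) / (8 * ((BSMX.piLo : ℚ) : ℝ) * c * N) +
    ((κ : ℝ) + 1) * (1 / (1 + (m₀ : ℝ))) ^ (2 * M) / (1 - (1 / (1 + (m₀ : ℝ))) ^ 2) with hXρ
  have h' := (Rat.cast_le (K := ℝ)).2 h
  push_cast at h'
  have hX' : Xρ ^ 2 ≤ ((Tn : ℝ) / DG) ^ 2 * (3 * (N : ℝ) + 1) := by rw [hXρ]; exact h'
  have hmR : (0 : ℝ) < m₀ := hF.2.2.2.2.2.2.2.1
  have hcR : (0 : ℝ) < c := hF.2.2.2.2.2.1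
  have hp0 : (0 : ℝ) < ((BSMX.piLo : ℚ) : ℝ) := by unfold BSMX.piLo; push_cast; norm_num
  have hρ1 : (1 : ℝ) / (1 + m₀) < 1 := by rw [div_lt_one (by linarith)]; linarith
  have hX0 : 0 ≤ Xρ := by
    have hNR : (0 : ℝ) < N := by exact_mod_cast hN
    have : 0 < 1 - ((1 : ℝ) / (1 + m₀)) ^ 2 := by nlinarith [(by positivity : (0 : ℝ) ≤ 1 / (1 + m₀))]
    positivity
  refine tailBound_two_fourierB hF hκ0 hκ1 ht hN ?_
  have huN := u_nonneg (d := 2) N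
  have hT0 : 0 ≤ (Tn : ℝ) / DG := by positivity
  have hle := BSMX.twoX_le hcR hmR hκ0 hMN hN
  have h1 : (u 2 N * Xρ) ^ 2 ≤ ((Tn : ℝ) / DG) ^ 2 := by
    rw [mul_pow]
    calc u 2 N ^ 2 * Xρ ^ 2 ≤ 1 / (3 * (N : ℝ) + 1) * (((Tn : ℝ) / DG) ^ 2 * (3 * (N : ℝ) + 1)) :=
          mul_le_mul (BSMX.u_two_sq_le N) hX' (by positivity) (by positivity)
      _ = ((Tn : ℝ) / DG) ^ 2 := by field_simp
  have h2 : u 2 N * Xρ ≤ (Tn : ℝ) / DG := (pow_le_pow_iff_left₀ (mul_nonneg huN hX0) hT0 two_ne_zero).1 h1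
  exact (mul_le_mul_of_nonneg_left (hle.trans (le_of_eq (by rw [hXρ]))) huN).trans h2

/-- **The Fourier `k ≥ 3` tail from a kernel check** (cut-off data): with `ρ = 1/(1+m₀)`,
`k · BQ k q₀ · (q₀+1) · [1/(8 piLo c N) + (κ+1) ρ^{2M}/((N+1)(1-ρ²))] ≤ Tn/DG` (`M ≤ N`, `N ≥ q₀ k`, `N ≥ 1`). -/
theorem tailBoundH_of_threeFourierQB (hk : 3 ≤ k) (ht : 2 ≤ t) {A : List ℕ} {DA : ℕ} (hA : LawNatOK m A DA)
    {θ₀ c m₀ κ : ℚ} (hq : FourierCheckQB m A DA θ₀ c m₀ κ) {q₀ M N : ℕ} (hN : q₀ * k ≤ N) (hN1 : 1 ≤ N)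
    (hMN : M ≤ N) {Tn DG : ℕ}
    (h : (k : ℚ) * BSMX.BQ k q₀ * ((q₀ : ℚ) + 1) *
        (1 / (8 * BSMX.piLo * c * N) + (κ + 1) * (1 / (1 + m₀)) ^ (2 * M) / (((N : ℚ) + 1) * (1 - (1 / (1 + m₀)) ^ 2))) ≤
      (Tn : ℚ) / DG) :
    TailBoundH t k m (lawN m A DA) N ((Tn : ℝ) / DG) := by
  obtain ⟨hF, hκ0, hκ1⟩ := fdataB_of_checkQ hA hq
  have hk0 : 0 < k := by omega
  have h' := (Rat.cast_le (K := ℝ)).2 h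
  push_cast at h'
  rw [BSMX.BQ_cast] at h'
  have hmR : (0 : ℝ) < m₀ := hF.2.2.2.2.2.2.2.1
  have hcR : (0 : ℝ) < c := hF.2.2.2.2.2.1
  have hNR : (0 : ℝ) < N := by exact_mod_cast hN1
  have hp := BSMX.piLo_le_pi
  have hp0 : (0 : ℝ) < ((BSMX.piLo : ℚ) : ℝ) := by unfold BSMX.piLo; push_cast; norm_num
  have hρ1 : (1 : ℝ) / (1 + m₀) < 1 := by rw [div_lt_one (by linarith)]; linarith
  refine tailBound_three_fourierB hF hκ0 hκ1 hk ht hN hN1 (le_trans ?_ h')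
  have hC : 0 ≤ BSMX.Cu k q₀ := BSMX.Cu_nonneg hk0 q₀
  unfold BSMX.Cu
  rw [show (k : ℝ) * B k q₀ * ((q₀ : ℝ) + 1) = BSMX.Cu k q₀ from rfl]
  refine mul_le_mul_of_nonneg_left (add_le_add ?_ ?_) hC
  · exact div_le_div_of_nonneg_left (by positivity) (by positivity) (by gcongr)
  · have hr : Real.exp (-(m₀ : ℝ)) ≤ 1 / (1 + m₀) := by
      rw [Real.exp_neg, inv_eq_one_div]
      exact one_div_le_one_div_of_le (by linarith) (by linarith [Real.add_one_le_exp (m₀ : ℝ)])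
    have hg := BSMX.geo_factor_le (Real.exp_pos (-(m₀ : ℝ))).le hr hρ1 hMN
    rw [mul_div_assoc, mul_div_assoc]
    refine mul_le_mul_of_nonneg_left ?_ (by positivity)
    have := div_le_div_of_nonneg_right hg (by positivity : (0 : ℝ) ≤ (N : ℝ) + 1)
    rw [div_div, div_div, mul_comm (1 - Real.exp (-(m₀ : ℝ)) ^ 2), mul_comm (1 - ((1 : ℝ) / (1 + m₀)) ^ 2)] at this
    exact this

end Summit.CriticalPhenomena.PercolationContinuityZ3.Theorems.Pcint.BSMR

end
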